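import Mathlib
import Summits.QuantumAdvantage.QuantumAdvantage.Theses.MobiusLadder
import Summits.QuantumAdvantage.QuantumAdvantage.Theorems.MobiusLadderDigitPolyUniformityDefs
import Summits.QuantumAdvantage.QuantumAdvantage.Theorems.MobiusLadderDigitPolyUniformityLARExistsDense
import Summits.QuantumAdvantage.QuantumAdvantage.Theorems.MobiusLadderDigitPolyUniformityLARCorrOneSided
import Summits.QuantumAdvantage.QuantumAdvantage.Theorems.MobiusLadderDigitPolyUniformityLARLowDegOneWalsh
import Summits.QuantumAdvantage.QuantumAdvantage.Theorems.MobiusLadderDigitPolyUniformityLARWalshCubeBound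
import Summits.QuantumAdvantage.QuantumAdvantage.Theorems.MobiusLadderDigitPolyUniformityLARLiouvilleCubeMean
import Summits.QuantumAdvantage.QuantumAdvantage.Theorems.MobiusLadderDigitPolyUniformityLARCorrCubeOfRange
import Literature.Computability.MetaComplexity.SmolenskyDimensionBound
import Literature.Computability.MetaComplexity.TruthTables
import Literature.Probability.RandomGraphs.LowDegree

/-!
# `DigitPolyUniformity` (stmt-QuantumAdvantage-1392), line `Sketch`/LAR — the INVERSE direction

Companion of the LAR skeleton (`Cruxes/DigitPolyUniformity/Lines/SketchLAR.lean`). There the crux is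
derived from the Liouville Annihilator Rank statement `stub_LAR` (annihilator ranks of the Liouville
digit set are `≤ ε2ⁿ` at all levels `k ≤ n/2 − ⌈ε√n⌉`). This file proves the converse-type facts that
calibrate that transfer, all stated definition-free (an arbitrary subspace `V` of functions vanishing on
`{λ(val b) = −1}`, resp. on `{λ(val b) ≠ −1}`, in place of `vanishOn (liouSet n)`):

* `finrank_inf_le_corr_neg` / `finrank_inf_le_corr_pos` — **annihilator rank ≤ one-sided correlation**:
  `dim (lowDeg k ⊓ V) ≤ C + |Σ_b λ(val b)| + 2` whenever every degree-`≤ k` phase has correlation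
  `≤ C` with `λ` (a subspace of dimension `R` contains an element supported on `≥ R/2` points —
  `stub_exists_dense`; a one-sided certifier of the sign of `λ` on `σ` points has correlation
  `≥ 2σ − |Σλ| − 2` — `stub_corr_oneSided`);
* `lar_of_digitPolyUniformity` — **the crux implies LAR at every polylogarithmic level**: from
  `DigitPolyUniformity`, for every `A`, `ε > 0`, eventually in `n`, all `k ≤ (log₂ n)^A` have both
  annihilator ranks `≤ ε 2ⁿ` (`stub_corr_cube_of_range` turns cube phases into crux phases;
  `stub_liouville_cube_mean` is the PNT for `λ`);
* `lar_level_one` — **LAR holds unconditionally at level `≤ 1`**, from the PROVED route item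
  `WalshLiouvilleBound` (`stub_walsh_cube_bound`) and `stub_lowDeg_one_walsh` (degree-`≤ 1` phases are
  `±` Walsh characters).

The same three statements in the vocabulary of the transferred crux (`annRank`, `liouSet` of
`Theorems/MobiusLadderDigitPolyUniformityDefs.lean`): `annRank_le_corr`, `annRank_le_of_digitPolyUniformity`,
`annRank_level_one`.

So the transfer is faithful at low levels — `DigitPolyUniformity ⇒ LAR(≤ (log₂n)^A)` and
`LAR(≤ n/2 − ⌈ε√n⌉) ⇒ DigitPolyUniformity` — and the open content of `stub_LAR` is exactly the range
of levels `((log₂ n)^A, n/2 − ⌈ε√n⌉]`.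
-/

noncomputable section

namespace Summit.QuantumAdvantage.DigitPolyUniformity.SketchLAR

open Filter Finset Module
open Literature.Computability.MetaComplexity (boolFunEquivFin)
open Literature.Computability.MetaComplexity.Smolensky (CubeFn mono lowDeg)
open Literature.Probability.RandomGraphs.LowDegree (walsh)
open Summit.QuantumAdvantage.QuantumAdvantage.Theses.MobiusLadder (DigitPolyUniformity)

/-! ### Annihilator rank ≤ one-sided correlation -/

/-- **Annihilator rank ≤ correlation (negative side).** If every degree-`≤ k` phase has correlation
`≤ C` with `λ` on the `n`-bit numbers, then every space of degree-`≤ k` functions vanishing on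
`{b : λ(val b) = −1}` has dimension `≤ C + |Σ_b λ(val b)| + 2`. [folklore] -/
theorem finrank_inf_le_corr_neg (n k : ℕ) (C : ℝ) (V : Submodule (ZMod 2) (CubeFn (ZMod 2) n))
    (hV : ∀ h ∈ V, ∀ b : Fin n → Bool,
      ArithmeticFunction.liouville ((boolFunEquivFin n b : Fin (2 ^ n)) : ℕ) = -1 → h b = 0)
    (hC : ∀ h : CubeFn (ZMod 2) n, h ∈ lowDeg (ZMod 2) n k →
      |∑ b : Fin n → Bool, ((ArithmeticFunction.liouville ((boolFunEquivFin n b : Fin (2 ^ n)) : ℕ) : ℤ) : ℝ) *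
          (if h b = 1 then (-1 : ℝ) else 1)| ≤ C) :
    (Module.finrank (ZMod 2) ↥(lowDeg (ZMod 2) n k ⊓ V) : ℝ) ≤
      C + |∑ b : Fin n → Bool,
        ((ArithmeticFunction.liouville ((boolFunEquivFin n b : Fin (2 ^ n)) : ℕ) : ℤ) : ℝ)| + 2 := by
  have hLabs := le_abs_self (∑ b : Fin n → Bool,
    ((ArithmeticFunction.liouville ((boolFunEquivFin n b : Fin (2 ^ n)) : ℕ) : ℤ) : ℝ))
  obtain ⟨h, hA, hdim⟩ := stub_exists_dense (lowDeg (ZMod 2) n k ⊓ V)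
  have hlow : h ∈ lowDeg (ZMod 2) n k := (Submodule.mem_inf.1 hA).1
  have hvan := hV h (Submodule.mem_inf.1 hA).2
  have h1 := (stub_corr_oneSided h).1 hvan
  have h2 := hC h hlow
  have hdim' : (Module.finrank (ZMod 2) ↥(lowDeg (ZMod 2) n k ⊓ V) : ℝ) ≤
      2 * ((univ.filter fun b => h b ≠ 0).card : ℝ) := by
    exact_mod_cast hdim
  have habs := (abs_le.1 h2).1
  linarith

/-- **Annihilator rank ≤ correlation (positive side).** If every degree-`≤ k` phase has correlation
`≤ C` with `λ` on the `n`-bit numbers, then every space of degree-`≤ k` functions vanishing on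
`{b : λ(val b) ≠ −1}` has dimension `≤ C + |Σ_b λ(val b)| + 2`. [folklore] -/
theorem finrank_inf_le_corr_pos (n k : ℕ) (C : ℝ) (V : Submodule (ZMod 2) (CubeFn (ZMod 2) n))
    (hV : ∀ h ∈ V, ∀ b : Fin n → Bool,
      ArithmeticFunction.liouville ((boolFunEquivFin n b : Fin (2 ^ n)) : ℕ) ≠ -1 → h b = 0)
    (hC : ∀ h : CubeFn (ZMod 2) n, h ∈ lowDeg (ZMod 2) n k →
      |∑ b : Fin n → Bool, ((ArithmeticFunction.liouville ((boolFunEquivFin n b : Fin (2 ^ n)) : ℕ) : ℤ) : ℝ) *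
          (if h b = 1 then (-1 : ℝ) else 1)| ≤ C) :
    (Module.finrank (ZMod 2) ↥(lowDeg (ZMod 2) n k ⊓ V) : ℝ) ≤
      C + |∑ b : Fin n → Bool,
        ((ArithmeticFunction.liouville ((boolFunEquivFin n b : Fin (2 ^ n)) : ℕ) : ℤ) : ℝ)| + 2 := by
  have hLabs' := neg_abs_le (∑ b : Fin n → Bool,
    ((ArithmeticFunction.liouville ((boolFunEquivFin n b : Fin (2 ^ n)) : ℕ) : ℤ) : ℝ))
  obtain ⟨h, hA, hdim⟩ := stub_exists_dense (lowDeg (ZMod 2) n k ⊓ V)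
  have hlow : h ∈ lowDeg (ZMod 2) n k := (Submodule.mem_inf.1 hA).1
  have hvan := hV h (Submodule.mem_inf.1 hA).2
  have h1 := (stub_corr_oneSided h).2 hvan
  have h2 := hC h hlow
  have hdim' : (Module.finrank (ZMod 2) ↥(lowDeg (ZMod 2) n k ⊓ V) : ℝ) ≤
      2 * ((univ.filter fun b => h b ≠ 0).card : ℝ) := by
    exact_mod_cast hdim
  have habs := (abs_le.1 h2).2
  linarith

/-! ### The crux implies LAR at polylogarithmic levels -/

/-- **`DigitPolyUniformity` implies LAR at every polylogarithmic level.** If `λ` is `ε`-orthogonal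
to all `𝔽₂`-polynomial phases of degree `≤ (log₂ n)^A` (the crux), then for every `A` and `ε > 0`,
eventually in `n`, for all `k ≤ (log₂ n)^A`, every space of degree-`≤ k` functions vanishing on
`{λ(val b) = −1}`, resp. on `{λ(val b) ≠ −1}`, has dimension `≤ ε 2ⁿ`. [folklore] -/
theorem lar_of_digitPolyUniformity (hDPU : DigitPolyUniformity) :
    ∀ A : ℕ, ∀ ε : ℝ, 0 < ε → ∀ᶠ n : ℕ in atTop, ∀ k : ℕ, k ≤ Nat.log 2 n ^ A →
      ∀ V : Submodule (ZMod 2) (CubeFn (ZMod 2) n),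
        ((∀ h ∈ V, ∀ b : Fin n → Bool,
            ArithmeticFunction.liouville ((boolFunEquivFin n b : Fin (2 ^ n)) : ℕ) = -1 → h b = 0) →
          (Module.finrank (ZMod 2) ↥(lowDeg (ZMod 2) n k ⊓ V) : ℝ) ≤ ε * 2 ^ n) ∧
        ((∀ h ∈ V, ∀ b : Fin n → Bool,
            ArithmeticFunction.liouville ((boolFunEquivFin n b : Fin (2 ^ n)) : ℕ) ≠ -1 → h b = 0) →
          (Module.finrank (ZMod 2) ↥(lowDeg (ZMod 2) n k ⊓ V) : ℝ) ≤ ε * 2 ^ n) := by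
  intro A ε hε
  have hcorr := hDPU A (ε / 4) (by positivity)
  have hmean := stub_liouville_cube_mean (ε / 4) (by positivity)
  have hbig : ∀ᶠ n : ℕ in atTop, 4 / ε ≤ (2 : ℝ) ^ n :=
    (tendsto_pow_atTop_atTop_of_one_lt one_lt_two).eventually_ge_atTop _
  filter_upwards [hcorr, hmean, hbig] with n hn hmn hbn
  intro k hk V
  -- every degree-`≤ k` cube phase is a crux phase of degree `≤ (log₂ n)^A`
  have hC : ∀ h : CubeFn (ZMod 2) n, h ∈ lowDeg (ZMod 2) n k →
      |∑ b : Fin n → Bool, ((ArithmeticFunction.liouville ((boolFunEquivFin n b : Fin (2 ^ n)) : ℕ) : ℤ) : ℝ) *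
          (if h b = 1 then (-1 : ℝ) else 1)| ≤ ε / 4 * 2 ^ n := by
    intro h hh
    obtain ⟨P, hPdeg, hPeq⟩ := stub_corr_cube_of_range h hh
    rw [hPeq]
    exact hn P (hPdeg.trans hk)
  have h2 : (1 : ℝ) ≤ ε / 4 * 2 ^ n := by
    have := mul_le_mul_of_nonneg_left hbn (show (0 : ℝ) ≤ ε / 4 by positivity)
    have h' : ε / 4 * (4 / ε) = 1 := by field_simp
    linarith
  constructor
  · intro hV
    have := finrank_inf_le_corr_neg n k (ε / 4 * 2 ^ n) V hV hC
    linarith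
  · intro hV
    have := finrank_inf_le_corr_pos n k (ε / 4 * 2 ^ n) V hV hC
    linarith

/-! ### LAR at level `≤ 1`, unconditionally -/

/-- **LAR holds at level `≤ 1`** (unconditional): for every `ε > 0`, eventually in `n`, every space of
degree-`≤ 1` (affine) functions vanishing on `{λ(val b) = −1}`, resp. on `{λ(val b) ≠ −1}`, has
dimension `≤ ε 2ⁿ`. From Bourgain's Möbius–Walsh bound for `λ` (PROVED route item
`WalshLiouvilleBound`): degree-`≤ 1` phases are `±` Walsh characters. [folklore] -/
theorem lar_level_one :
    ∀ ε : ℝ, 0 < ε → ∀ᶠ n : ℕ in atTop, ∀ k : ℕ, k ≤ 1 →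
      ∀ V : Submodule (ZMod 2) (CubeFn (ZMod 2) n),
        ((∀ h ∈ V, ∀ b : Fin n → Bool,
            ArithmeticFunction.liouville ((boolFunEquivFin n b : Fin (2 ^ n)) : ℕ) = -1 → h b = 0) →
          (Module.finrank (ZMod 2) ↥(lowDeg (ZMod 2) n k ⊓ V) : ℝ) ≤ ε * 2 ^ n) ∧
        ((∀ h ∈ V, ∀ b : Fin n → Bool,
            ArithmeticFunction.liouville ((boolFunEquivFin n b : Fin (2 ^ n)) : ℕ) ≠ -1 → h b = 0) →
          (Module.finrank (ZMod 2) ↥(lowDeg (ZMod 2) n k ⊓ V) : ℝ) ≤ ε * 2 ^ n) := by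
  intro ε hε
  obtain ⟨c, hc, hwalsh⟩ := stub_walsh_cube_bound
  have hmean := stub_liouville_cube_mean (ε / 4) (by positivity)
  have hbig : ∀ᶠ n : ℕ in atTop, 4 / ε ≤ (2 : ℝ) ^ n :=
    (tendsto_pow_atTop_atTop_of_one_lt one_lt_two).eventually_ge_atTop _
  -- `2^{n − n^c} ≤ (ε/4) 2^n` eventually, i.e. `2^{−n^c} ≤ ε/4`
  have hdecay : ∀ᶠ n : ℕ in atTop, (2 : ℝ) ^ ((n : ℝ) - (n : ℝ) ^ c) ≤ ε / 4 * 2 ^ n := by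
    have hpow : Tendsto (fun n : ℕ => ((n : ℝ) ^ c)) atTop atTop :=
      (tendsto_rpow_atTop hc).comp tendsto_natCast_atTop_atTop
    have hev : ∀ᶠ n : ℕ in atTop, Real.logb 2 (4 / ε) ≤ (n : ℝ) ^ c := hpow.eventually_ge_atTop _
    filter_upwards [hev] with n hn
    have h2 : (1 : ℝ) < 2 := one_lt_two
    have hle : (2 : ℝ) ^ (-(n : ℝ) ^ c) ≤ ε / 4 := by
      have := Real.rpow_le_rpow_of_exponent_le h2.le (neg_le_neg hn)
      refine this.trans ?_
      rw [Real.rpow_neg zero_le_two, Real.rpow_logb two_pos (by norm_num) (by positivity)]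
      rw [inv_div]
    calc (2 : ℝ) ^ ((n : ℝ) - (n : ℝ) ^ c) = 2 ^ (n : ℝ) * 2 ^ (-(n : ℝ) ^ c) := by
          rw [sub_eq_add_neg, Real.rpow_add two_pos]
      _ ≤ 2 ^ (n : ℝ) * (ε / 4) := mul_le_mul_of_nonneg_left hle (by positivity)
      _ = ε / 4 * 2 ^ n := by rw [Real.rpow_natCast]; ring
  filter_upwards [hwalsh, hmean, hbig, hdecay] with n hwn hmn hbn hdn
  intro k hk V
  have hC : ∀ h : CubeFn (ZMod 2) n, h ∈ lowDeg (ZMod 2) n k →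
      |∑ b : Fin n → Bool, ((ArithmeticFunction.liouville ((boolFunEquivFin n b : Fin (2 ^ n)) : ℕ) : ℤ) : ℝ) *
          (if h b = 1 then (-1 : ℝ) else 1)| ≤ ε / 4 * 2 ^ n := by
    intro h hh
    have hh1 : h ∈ lowDeg (ZMod 2) n 1 :=
      Literature.Computability.MetaComplexity.Smolensky.lowDeg_mono hk hh
    obtain ⟨S, c', hc', hphase⟩ := stub_lowDeg_one_walsh h hh1
    have hrw : ∑ b : Fin n → Bool,
        ((ArithmeticFunction.liouville ((boolFunEquivFin n b : Fin (2 ^ n)) : ℕ) : ℤ) : ℝ) *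
          (if h b = 1 then (-1 : ℝ) else 1) =
        c' * ∑ b : Fin n → Bool,
          ((ArithmeticFunction.liouville ((boolFunEquivFin n b : Fin (2 ^ n)) : ℕ) : ℤ) : ℝ) * walsh S b := by
      rw [Finset.mul_sum]
      refine Finset.sum_congr rfl fun b _ => ?_
      rw [hphase b]
      ring
    rw [hrw, abs_mul]
    have habs1 : |c'| = 1 := by
      rcases hc' with rfl | rfl <;> simp
    rw [habs1, one_mul]
    exact (hwn S).trans hdn
  have h2 : (1 : ℝ) ≤ ε / 4 * 2 ^ n := by
    have := mul_le_mul_of_nonneg_left hbn (show (0 : ℝ) ≤ ε / 4 by positivity)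
    have h' : ε / 4 * (4 / ε) = 1 := by field_simp
    linarith
  constructor
  · intro hV
    have := finrank_inf_le_corr_neg n k (ε / 4 * 2 ^ n) V hV hC
    linarith
  · intro hV
    have := finrank_inf_le_corr_pos n k (ε / 4 * 2 ^ n) V hV hC
    linarith

/-! ### The same in the vocabulary of the transferred crux -/

/-- **Annihilator rank ≤ correlation**, `annRank`/`liouSet` form: if every degree-`≤ k` phase has
correlation `≤ C` with `λ`, then `annRank_k (liouSet n)` and `annRank_k (liouSet n)ᶜ` are both
`≤ C + |Σ_b λ(val b)| + 2`. [folklore] -/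
theorem annRank_le_corr (n k : ℕ) (C : ℝ)
    (hC : ∀ h : CubeFn (ZMod 2) n, h ∈ lowDeg (ZMod 2) n k →
      |∑ b : Fin n → Bool, ((ArithmeticFunction.liouville ((boolFunEquivFin n b : Fin (2 ^ n)) : ℕ) : ℤ) : ℝ) *
          (if h b = 1 then (-1 : ℝ) else 1)| ≤ C) :
    (annRank (ZMod 2) n k (liouSet n) : ℝ) ≤
        C + |∑ b : Fin n → Bool,
          ((ArithmeticFunction.liouville ((boolFunEquivFin n b : Fin (2 ^ n)) : ℕ) : ℤ) : ℝ)| + 2 ∧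
      (annRank (ZMod 2) n k (liouSet n)ᶜ : ℝ) ≤
        C + |∑ b : Fin n → Bool,
          ((ArithmeticFunction.liouville ((boolFunEquivFin n b : Fin (2 ^ n)) : ℕ) : ℤ) : ℝ)| + 2 :=
  ⟨finrank_inf_le_corr_neg n k C (vanishOn (ZMod 2) (liouSet n)) (fun _ hh b hb => hh b hb) hC,
    finrank_inf_le_corr_pos n k C (vanishOn (ZMod 2) (liouSet n)ᶜ) (fun _ hh b hb => hh b hb) hC⟩

/-- **The crux implies LAR at every polylogarithmic level**, `annRank` form. [folklore] -/
theorem annRank_le_of_digitPolyUniformity (hDPU : DigitPolyUniformity) :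
    ∀ A : ℕ, ∀ ε : ℝ, 0 < ε → ∀ᶠ n : ℕ in atTop, ∀ k : ℕ, k ≤ Nat.log 2 n ^ A →
      (annRank (ZMod 2) n k (liouSet n) : ℝ) ≤ ε * 2 ^ n ∧
        (annRank (ZMod 2) n k (liouSet n)ᶜ : ℝ) ≤ ε * 2 ^ n := by
  intro A ε hε
  filter_upwards [lar_of_digitPolyUniformity hDPU A ε hε] with n hn
  intro k hk
  exact ⟨(hn k hk (vanishOn (ZMod 2) (liouSet n))).1 (fun _ hh b hb => hh b hb),
    (hn k hk (vanishOn (ZMod 2) (liouSet n)ᶜ)).2 (fun _ hh b hb => hh b hb)⟩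

/-- **LAR holds at level `≤ 1`**, `annRank` form (unconditional, from the proved
`WalshLiouvilleBound`). [folklore] -/
theorem annRank_level_one :
    ∀ ε : ℝ, 0 < ε → ∀ᶠ n : ℕ in atTop, ∀ k : ℕ, k ≤ 1 →
      (annRank (ZMod 2) n k (liouSet n) : ℝ) ≤ ε * 2 ^ n ∧
        (annRank (ZMod 2) n k (liouSet n)ᶜ : ℝ) ≤ ε * 2 ^ n := by
  intro ε hε
  filter_upwards [lar_level_one ε hε] with n hn
  intro k hk
  exact ⟨(hn k hk (vanishOn (ZMod 2) (liouSet n))).1 (fun _ hh b hb => hh b hb),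
    (hn k hk (vanishOn (ZMod 2) (liouSet n)ᶜ)).2 (fun _ hh b hb => hh b hb)⟩

end Summit.QuantumAdvantage.DigitPolyUniformity.SketchLAR

end
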